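import Summits.PneNP.PneNP.Theses.Circuit
import Literature.Computability.Complexity.ACRealizeConnectives

/-!
# `CircuitNpTc0` (stmt-PneNP-0039, route `Circuit`): the polynomial size bound is load-bearing;
# sparse and co-sparse witnesses are excluded

Negative knowledge for the crux
`Summit.PneNP.PneNP.Theses.Circuit.CircuitNpTc0 = ¬ (NP ⊆ TC0)` (refuter, cdisprove cycle 1; the crux is
the open problem `NP ⊄ non-uniform TC⁰` and is NOT refuted — this file asserts no Theses declaration):

* `acReal_dnf`: every Boolean function on `n` bits is a depth-2 `∧,∨,¬` circuit (DNF) with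
  `T·(n+1)+1` gates, `T` its number of true points; hence EVERY language has depth-2 circuits of size
  `2ⁿ(n+1)+1` over `acBasis ⊆ tcBasis` (`mem_depthSizeClass_two_exp`).
* `circuitNpTc0_false_without_sizeBound`: the crux with the polynomial size bound dropped (constant
  depth kept), `¬ (NP ⊆ TC0NoSizeBound)`, is FALSE — `NP ⊆` depth-2, size-`2ⁿ(n+1)+1` threshold
  circuits (`NP_subset_depthTwo_expSize`). Any proof of the crux is a size/counting argument.
* `not_exists_sparse_witness`: the natural strengthening "some polynomially SPARSE or co-sparse `NP`
  language is outside `TC⁰`" is false: such languages are in `AC⁰₂ ⊆ TC⁰` whatever their uniform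
  complexity (`mem_TC0_of_isPolySparse`, `mem_TC0_of_isPolySparse_compl`). A witness of the crux is
  dense and co-dense at infinitely many lengths.

Work file with the full census: `Summits/PneNP/PneNP/Cruxes/CircuitNpTc0/Disproof.lean`.
-/

-- `Summit.<Summit>.<Problem>`: for the single-conjunct summit `PneNP` the duplicate `PneNP.PneNP` is mandated.
set_option linter.dupNamespace false

namespace Summit.PneNP.PneNP.Theorems.CircuitNpTc0.Negative

open Literature.Computability.Complexity

/-! ### Every Boolean function is a depth-2 DNF -/

/-- The number of accepted inputs of length `n` (true points of the `n`-th slice). [folklore] -/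
noncomputable def yesCount (L : Language Bool) (n : ℕ) : ℕ :=
  Fintype.card {a : Fin n → Bool // L.sliceFn n a = true}

/-- `yesCount L n ≤ 2ⁿ`. [folklore] -/
theorem yesCount_le_two_pow (L : Language Bool) (n : ℕ) : yesCount L n ≤ 2 ^ n := by
  unfold yesCount
  refine (Fintype.card_subtype_le _).trans ?_
  simp

/-- **DNF at depth 2.** Every Boolean function `g` on `n` bits is realised over `acBasis` with
`acDepth ≤ 2` and at most `T·(n+1)+1` gates, `T` the number of true points of `g`: the `∨` of the
minterms of its true points (negations are free in `acDepth`) (Vollmer 1999, §1.1). [folklore] -/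
theorem acReal_dnf {n : ℕ} (g : (Fin n → Bool) → Bool) :
    ACReal g 2 (Fintype.card {a : Fin n → Bool // g a = true} * (n * 1 + 1) + 1) := by
  -- minterm of a fixed assignment `a`: the `∧` of the `n` literals `[x k = a k]`
  have hmin' : ∀ t : {a : Fin n → Bool // g a = true},
      ACReal (fun x : Fin n → Bool => decide (x = t.1)) 1 (n * 1 + 1) := by
    intro t
    have hmin := acReal_forall_fintype fun k : Fin n => acReal_lit (ι := Fin n) k (t.1 k)
    refine (hmin.congr fun x => ?_).mono le_rfl (by simp)
    simp only [decide_eq_true_eq, decide_eq_decide]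
    exact ⟨fun h => funext h, fun h k => by rw [h]⟩
  have hex := acReal_exists_fintype hmin'
  refine (hex.congr fun x => ?_).mono le_rfl le_rfl
  rw [Bool.eq_iff_iff]
  simp only [decide_eq_true_eq]
  constructor
  · rintro ⟨t, ht⟩
    rw [ht]; exact t.2
  · intro hx
    exact ⟨⟨x, hx⟩, rfl⟩

/-- Circuit form of `acReal_dnf`. [folklore] -/
theorem exists_dnf_circuit {n : ℕ} (g : (Fin n → Bool) → Bool) :
    ∃ C : Circuit (Fin n), C.IsOver acBasis ∧ C.acDepth ≤ 2 ∧
      C.size ≤ Fintype.card {a : Fin n → Bool // g a = true} * (n + 1) + 1 ∧ ∀ x, C.eval x = g x := by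
  simpa using (acReal_dnf g).toCircuit

/-- A family computing the slices decides the language. [folklore] -/
theorem decides_of_eval_sliceFn {L : Language Bool} {C : CircuitFamily}
    (h : ∀ n x, (C n).eval x = L.sliceFn n x) : C.Decides L := by
  intro x
  rw [h]
  show L.boolIndicator (List.ofFn x.get) = L.boolIndicator x
  rw [List.ofFn_get]

/-- **Every language has depth-2 `acBasis` circuits of size `yesCount·(n+1)+1`.** [folklore] -/
theorem mem_depthSizeClass_yesCount (L : Language Bool) :
    L ∈ DepthSizeClass acBasis (fun _ => 2) (fun n => yesCount L n * (n + 1) + 1) := by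
  choose C hC using fun n => exists_dnf_circuit (L.sliceFn n)
  exact ⟨C, fun n => ⟨(hC n).1, (hC n).2.1, (hC n).2.2.1⟩,
    decides_of_eval_sliceFn fun n x => (hC n).2.2.2 x⟩

/-- **Every language — decidable or not — has depth-2 circuits of size `2ⁿ(n+1)+1` over
`acBasis ⊆ tcBasis`** (Shannon–Lupanov at depth 2). [folklore] -/
theorem mem_depthSizeClass_two_exp (L : Language Bool) :
    L ∈ DepthSizeClass tcBasis (fun _ => 2) (fun n => 2 ^ n * (n + 1) + 1) :=
  DepthSizeClass_mono acBasis_subset_tcBasis (fun _ => le_rfl)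
    (fun n => Nat.succ_le_succ (Nat.mul_le_mul_right _ (yesCount_le_two_pow L n)))
    (mem_depthSizeClass_yesCount L)

/-! ### The crux without the size bound is false -/

/-- `TC⁰` with the polynomial size bound DROPPED (constant depth, arbitrary size). [folklore] -/
def TC0NoSizeBound : Set (Language Bool) :=
  {L | ∃ d : ℕ, ∃ s : ℕ → ℕ, L ∈ DepthSizeClass tcBasis (fun _ => d) s}

/-- Without the size bound the class is everything (depth 2 suffices). [folklore] -/
theorem TC0NoSizeBound_eq_univ : TC0NoSizeBound = Set.univ :=
  Set.eq_univ_of_forall fun L => ⟨2, _, mem_depthSizeClass_two_exp L⟩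

/-- `NP` (like every class of languages) lies inside constant-depth threshold circuits of
unrestricted size. [folklore] -/
theorem NP_subset_TC0NoSizeBound : Nondeterministic.NP ⊆ TC0NoSizeBound := by
  rw [TC0NoSizeBound_eq_univ]
  exact Set.subset_univ _

/-- **The polynomial size bound of `CircuitNpTc0` is load-bearing**: the crux with its size bound
dropped, `¬ (NP ⊆ TC0NoSizeBound)` ("`NP ⊄` constant-depth threshold circuits of ANY size"), is
FALSE — already at depth 2 and size `2ⁿ(n+1)+1`. [folklore] -/
theorem circuitNpTc0_false_without_sizeBound : ¬ (¬ (Nondeterministic.NP ⊆ TC0NoSizeBound)) :=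
  fun h => h NP_subset_TC0NoSizeBound

/-- Sharper form: `NP ⊆` depth-2, size-`2ⁿ(n+1)+1` circuits over `tcBasis` (indeed over `∧,∨,¬`).
[folklore] -/
theorem NP_subset_depthTwo_expSize :
    Nondeterministic.NP ⊆ DepthSizeClass tcBasis (fun _ => 2) (fun n => 2 ^ n * (n + 1) + 1) :=
  fun L _ => mem_depthSizeClass_two_exp L

/-! ### Sparse and co-sparse languages are in `AC⁰₂ ⊆ TC⁰` -/

/-- Polynomially sparse: at most `q(n)` accepted strings of each length `n`. [folklore] -/
def IsPolySparse (L : Language Bool) : Prop :=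
  ∃ q : Polynomial ℕ, ∀ n, yesCount L n ≤ q.eval n

/-- `AC⁰ ⊆ TC⁰` (basis monotonicity). [folklore] -/
theorem AC0_subset_TC0 : AC0 ⊆ TC0 := by
  rintro L ⟨d, p, hL⟩
  exact ⟨d, p, DepthSizeClass_mono acBasis_subset_tcBasis (fun _ => le_rfl) (fun _ => le_rfl) hL⟩

/-- `AC⁰_d ⊆ AC⁰`. [folklore] -/
theorem ACd_subset_AC0 (d : ℕ) : ACd d ⊆ AC0 := by
  intro L hL
  rw [AC0_eq_iUnion_ACd]
  exact Set.mem_iUnion.2 ⟨d, hL⟩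

/-- **Sparse languages are in `AC⁰` at depth 2** (DNF over the accepted strings), whatever their
uniform complexity. [folklore] -/
theorem mem_ACd_two_of_isPolySparse {L : Language Bool} (h : IsPolySparse L) : L ∈ ACd 2 := by
  obtain ⟨q, hq⟩ := h
  refine Set.mem_iUnion.2 ⟨q * (Polynomial.X + 1) + 1, ?_⟩
  refine DepthSizeClass_mono le_rfl (fun _ => le_rfl) (fun n => ?_) (mem_depthSizeClass_yesCount L)
  simp only [Polynomial.eval_add, Polynomial.eval_mul, Polynomial.eval_X, Polynomial.eval_one]
  exact Nat.succ_le_succ (Nat.mul_le_mul_right _ (hq n))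

/-- Hence sparse languages are in `TC⁰`. [folklore] -/
theorem mem_TC0_of_isPolySparse {L : Language Bool} (h : IsPolySparse L) : L ∈ TC0 :=
  AC0_subset_TC0 (ACd_subset_AC0 2 (mem_ACd_two_of_isPolySparse h))

/-- Co-sparse languages are in `AC⁰` at depth 2 as well (negate the DNF of the complement; `¬` is
free in `acDepth`, one extra gate). [folklore] -/
theorem mem_ACd_two_of_isPolySparse_compl {L : Language Bool} (h : IsPolySparse Lᶜ) : L ∈ ACd 2 := by
  obtain ⟨q, hq⟩ := h
  refine Set.mem_iUnion.2 ⟨q * (Polynomial.X + 1) + 2, ?_⟩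
  have key : ∀ n, ∃ C : Circuit (Fin n), C.IsOver acBasis ∧ C.acDepth ≤ 2 ∧
      C.size ≤ yesCount Lᶜ n * (n + 1) + 1 + 1 ∧ ∀ x, C.eval x = L.sliceFn n x := by
    intro n
    have h1 := (acReal_dnf (Lᶜ.sliceFn n)).neg
    have h2 : ACReal (L.sliceFn n) 2 (yesCount Lᶜ n * (n * 1 + 1) + 1 + 1) := by
      refine h1.congr fun x => ?_
      show (!Lᶜ.boolIndicator (List.ofFn x)) = L.boolIndicator (List.ofFn x)
      by_cases hx : List.ofFn x ∈ L
      · rw [(Set.mem_iff_boolIndicator _ _).1 hx,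
          (Set.notMem_iff_boolIndicator _ _).1 (show List.ofFn x ∉ Lᶜ from fun h => h hx)]
        rfl
      · rw [(Set.notMem_iff_boolIndicator _ _).1 hx,
          (Set.mem_iff_boolIndicator _ _).1 (show List.ofFn x ∈ Lᶜ from hx)]
        rfl
    simpa using h2.toCircuit
  choose C hC using key
  refine ⟨C, fun n => ⟨(hC n).1, (hC n).2.1, (hC n).2.2.1.trans ?_⟩,
    decides_of_eval_sliceFn fun n x => (hC n).2.2.2 x⟩
  simp only [Polynomial.eval_add, Polynomial.eval_mul, Polynomial.eval_X, Polynomial.eval_one,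
    Polynomial.eval_ofNat]
  have := hq n
  nlinarith

/-- Hence co-sparse languages are in `TC⁰`. [folklore] -/
theorem mem_TC0_of_isPolySparse_compl {L : Language Bool} (h : IsPolySparse Lᶜ) : L ∈ TC0 :=
  AC0_subset_TC0 (ACd_subset_AC0 2 (mem_ACd_two_of_isPolySparse_compl h))

/-- **Refuted strengthening of `CircuitNpTc0` (sparse witness)**: "some SPARSE or co-sparse `NP`
language lies outside `TC⁰`" is false. A witness of the crux is dense and co-dense at infinitely many
lengths. [folklore] -/
theorem not_exists_sparse_witness :
    ¬ ∃ L ∈ Nondeterministic.NP, (IsPolySparse L ∨ IsPolySparse Lᶜ) ∧ L ∉ TC0 := by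
  rintro ⟨L, -, hs | hs, hL⟩
  · exact hL (mem_TC0_of_isPolySparse hs)
  · exact hL (mem_TC0_of_isPolySparse_compl hs)

end Summit.PneNP.PneNP.Theorems.CircuitNpTc0.Negative
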